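import Summits.AtomisticToContinuum.FouriersLaw.Theses.ContactStieltjesMeasure
import Summits.AtomisticToContinuum.FouriersLaw.Theorems.ContactStieltjesMeasureStieltjesRepresentationOfPhi4Edge

/-!
# Crux `ContactStieltjesMeasure.StieltjesRepresentation` (stmt-AtomisticToContinuum-15248): the REPAIRED statement, proved

Support file (`--supports stmt-AtomisticToContinuum-15248`, registered sub-goal `stub_stieltjesRepresentation_offPhi4`) of line
`cayley-pencil` (continuation lead c1).

The crux as filed quantifies over the closed range `0 ≤ lam`, `0 ≤ β` of `pinnedChain ω₂ lam β γ`. Everything on that range is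
proved in the tree EXCEPT the `φ⁴` corner `β = 0 < lam` (quartic pinning, HARMONIC coupling): there the clause's own hypotheses
(weak-NESS uniqueness AND a steady family for EVERY chain length `N'`) are open — existence of the steady state of the discrete
`φ⁴` chain is proved for three oscillators only (Hairer–Mattingly 2009; Cuneo–Eckmann–Hairer–Rey-Bellet 2018 §1) — and its
conclusion (finite-`N` linear response in Green–Kubo, a fortiori Stieltjes, form) needs an equilibrium mixing theory that is
not in print for pinning-dominated chains (no compact resolvent / `0` in the essential spectrum: Hairer–Mattingly 2009,
Thm 3.11, Rem 3.12, Thm 3.13; barrier `Literature.Barriers.AtomisticToContinuum.HairerMattingly2009_threeOscillators`). That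
corner can be neither proved nor refuted today, so the crux is mis-stated in its RANGE.

This file proves the repaired statement VERBATIM, in the two natural shapes a planner may restate it:

* `stub_stieltjesRepresentation_offPhi4` — the crux with the single extra guard `(0 < β ∨ lam = 0)` (i.e. the `φ⁴` corner
  `β = 0 < lam` excised, the harmonic calibration member `lam = β = 0` KEPT): case split into the landed
  `CayleyPencil.stub_stieltjesRepresentation_pos` (`0 ≤ lam`, `0 < β`) and `CayleyPencil.stub_harmonicMember` (`lam = β = 0`);
* `stieltjesRepresentation_pos_range` — the crux with `0 ≤ β` replaced by `0 < β` (the range `closes` consumes), a restatement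
  of `CayleyPencil.stub_stieltjesRepresentation_pos` kept next to the first for the planner's convenience.

No definitions, no named facts, no `sorry`.
-/

noncomputable section

open scoped Topology
open MeasureTheory Filter Set
open Literature.MathematicalPhysics.KineticTheory.HeatConduction

namespace Summit.AtomisticToContinuum.FouriersLaw.Theorems.ContactStieltjesMeasure.CayleyPencil

/-- **The repaired crux (registered sub-goal `stub_stieltjesRepresentation_offPhi4`).** `StieltjesRepresentation` with the one
extra guard `(0 < β ∨ lam = 0)` excising the `φ⁴` corner `β = 0 < lam`: for `ω₂ > 0`, `lam ≥ 0`, `β ≥ 0` with `β > 0` or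
`lam = 0`, and `T > 0`, there is ONE `γ`-free family of bounded monotone `Φ_N` (`N ≥ 2`) vanishing on `(-∞,0]` such that for
every friction `γ > 0`, under weak-NESS uniqueness and along every steady family,
`totalCurrent(μ_{N,T+δ/2,T-δ/2})/δ → (N-1)·γ·∫₀^∞ Φ_N(t)·2t/(γ²+t²)² dt`. Cases: `0 < β` is
`stub_stieltjesRepresentation_pos` (dissipative pencil + Cayley isometry + Herglotz, line `cayley-pencil`); `β = 0` forces
`lam = 0`, the harmonic member `stub_harmonicMember` (finite partial fractions, `N-1` Chebyshev atoms).
[cite: LaxPhillips1967, Ch. II §3] [cite: CuneoEckmannHairerReyBellet2018, Thm 2.13] [cite: HairerMattingly2009, §1] -/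
theorem stub_stieltjesRepresentation_offPhi4 :
    ∀ ω₂ lam β : ℝ, 0 < ω₂ → 0 ≤ lam → 0 ≤ β → (0 < β ∨ lam = 0) → ∀ T : ℝ, 0 < T → ∃ Φ : ℕ → ℝ → ℝ, ∀ N : ℕ, 2 ≤ N → Monotone (Φ N) ∧ (∀ s : ℝ, s ≤ 0 → Φ N s = 0) ∧ (∃ m : ℝ, ∀ s : ℝ, Φ N s ≤ m) ∧ ∀ γ : ℝ, 0 < γ → (∀ (N' : ℕ) (T_L T_R : ℝ), 0 < T_L → 0 < T_R → ∀ μ ν : MeasureTheory.Measure (Literature.MathematicalPhysics.KineticTheory.HeatConduction.PhaseSpace N'), (Literature.MathematicalPhysics.KineticTheory.HeatConduction.pinnedChain ω₂ lam β γ).IsSteadyState N' T_L T_R μ → (Literature.MathematicalPhysics.KineticTheory.HeatConduction.pinnedChain ω₂ lam β γ).IsSteadyState N' T_L T_R ν → μ = ν) → ∀ μ : (N' : ℕ) → ℝ → ℝ → MeasureTheory.Measure (Literature.MathematicalPhysics.KineticTheory.HeatConduction.PhaseSpace N'), (∀ (N' : ℕ) (T_L T_R : ℝ), 0 < T_L →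 0 < T_R → (Literature.MathematicalPhysics.KineticTheory.HeatConduction.pinnedChain ω₂ lam β γ).IsSteadyState N' T_L T_R (μ N' T_L T_R)) → Filter.Tendsto (fun δ : ℝ => (Literature.MathematicalPhysics.KineticTheory.HeatConduction.pinnedChain ω₂ lam β γ).totalCurrent (μ N (T + δ / 2) (T - δ / 2)) / δ) (nhdsWithin 0 {(0 : ℝ)}ᶜ) (nhds (((N : ℝ) - 1) * γ * ∫ t in Set.Ioi (0 : ℝ), Φ N t * (2 * t / (γ ^ 2 + t ^ 2) ^ 2))) := by
  intro ω₂ lam β hω hl hβ hguard T hT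
  rcases hβ.eq_or_lt with hβ0 | hβpos
  · -- `β = 0`: the guard forces `lam = 0`, the harmonic member
    subst hβ0
    have hl0 : lam = 0 := by
      rcases hguard with h | h
      · exact absurd h (lt_irrefl 0)
      · exact h
    subst hl0
    exact stub_harmonicMember ω₂ hω T hT
  · -- `0 < β`, `0 ≤ lam`: the positive range
    exact stub_stieltjesRepresentation_pos ω₂ lam β hω hl hβpos T hT

/-- **The crux on the range `closes` consumes**: `StieltjesRepresentation` with `0 ≤ β` replaced by `0 < β` — verbatim the
landed `stub_stieltjesRepresentation_pos`, restated here beside the guarded form so that either planner restatement of the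
mis-ranged crux closes by `exact`. [cite: LaxPhillips1967, Ch. II §3] [cite: CuneoEckmannHairerReyBellet2018, Thm 2.13] -/
theorem stieltjesRepresentation_pos_range :
    ∀ ω₂ lam β : ℝ, 0 < ω₂ → 0 ≤ lam → 0 < β → ∀ T : ℝ, 0 < T → ∃ Φ : ℕ → ℝ → ℝ, ∀ N : ℕ, 2 ≤ N → Monotone (Φ N) ∧ (∀ s : ℝ, s ≤ 0 → Φ N s = 0) ∧ (∃ m : ℝ, ∀ s : ℝ, Φ N s ≤ m) ∧ ∀ γ : ℝ, 0 < γ → (∀ (N' : ℕ) (T_L T_R : ℝ), 0 < T_L → 0 < T_R → ∀ μ ν : MeasureTheory.Measure (Literature.MathematicalPhysics.KineticTheory.HeatConduction.PhaseSpace N'), (Literature.MathematicalPhysics.KineticTheory.HeatConduction.pinnedChain ω₂ lam β γ).IsSteadyState N' T_L T_R μ → (Literature.MathematicalPhysics.KineticTheory.HeatConduction.pinnedChain ω₂ lam β γ).IsSteadyState N' T_L T_R ν → μ = ν) → ∀ μ : (N' : ℕ) → ℝ → ℝ → MeasureTheory.Measure (Literature.MathematicalPhysics.KineticTheory.HeatConduction.PhaseSpace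 N'), (∀ (N' : ℕ) (T_L T_R : ℝ), 0 < T_L → 0 < T_R → (Literature.MathematicalPhysics.KineticTheory.HeatConduction.pinnedChain ω₂ lam β γ).IsSteadyState N' T_L T_R (μ N' T_L T_R)) → Filter.Tendsto (fun δ : ℝ => (Literature.MathematicalPhysics.KineticTheory.HeatConduction.pinnedChain ω₂ lam β γ).totalCurrent (μ N (T + δ / 2) (T - δ / 2)) / δ) (nhdsWithin 0 {(0 : ℝ)}ᶜ) (nhds (((N : ℝ) - 1) * γ * ∫ t in Set.Ioi (0 : ℝ), Φ N t * (2 * t / (γ ^ 2 + t ^ 2) ^ 2))) :=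
  fun ω₂ lam β hω hl hβ T hT => stub_stieltjesRepresentation_offPhi4 ω₂ lam β hω hl hβ.le (Or.inl hβ) T hT

end Summit.AtomisticToContinuum.FouriersLaw.Theorems.ContactStieltjesMeasure.CayleyPencil

end
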